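import Summits.CriticalPhenomena.SAWScalingLimit.Theorems.SAWTwistedSelfEnergyEventualTightOfUMA
import Summits.CriticalPhenomena.SAWScalingLimit.Theorems.ShellCrossingBound.Negative.OfEventualTight
import HarnessLib

/-!
# Anatomy of the unordered-Markov fibre atom UMA (line `SketchIdeator2_1881`, crux stmt-CriticalPhenomena-1881)

Honesty certificates for the one open stub `stub_UMA` of the line `SketchIdeator2_1881` (card
`unordered-markov-fibres`), whose glue `EventualTight_of_uma : UMA → SAWTwistedSelfEnergy.EventualTight` is
landed (`SAWTwistedSelfEnergyEventualTightOfUMA.lean`).  Three registered stubs of the crux item are proved: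

* `EventualTight_of_umaAvg` — the AVERAGED atom (the same joint event "`k` separate traversals of `D(y; ts, s)`
  and NOT `m` of `D(y; 6s/5, 2s)`", but bounded in law instead of fibrewise) already implies the crux, by the
  same induction down the scale ranges `(R₀/2ⁿ, R₀]` with the free base (the one-scale step is now the bare union
  bound `P[A] ≤ P[C] + P[A ∩ Cᶜ]`);
* `umaAvg_of_EventualTight` — conversely the crux implies the averaged atom (a compact set of curve classes
  bounds the traversal count of every genuine shell, `exists_forall_not_hasTraversals_of_isCompact`): so the
  averaged atom is crux-EQUIVALENT, and the surplus of UMA over the crux is exactly its FIBREWISE uniformity;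
* `umaTop_of_EventualTight` — at the top scales (`Ω ⊆ B(y, 2s)`: no lattice edge of any walk has an endpoint at
  mesh distance `≥ 2s`, so every fibre of the outside trace is everything) UMA is literally per-shell tightness
  of `D(y; ts, s)` and follows from the crux: the fibrewise surplus lives only at scales `2s` not covering `Ω`.

References: Aizenman–Burchard, Duke Math. J. 99 (1999), §1.b and Lemma 4.1 (traversal counts of compact families);
Kemppainen–Smirnov, Ann. Probab. 45 (2017) §2 (one-scale conditional crossing statements).
-/

noncomputable section

open MeasureTheory Filter Topology Set Metric
open scoped ENNReal NNReal unitInterval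
open Literature.Probability.RandomPlanarGeometry Literature.Probability.LatticeModels

namespace Summit.CriticalPhenomena.SAWScalingLimit.Theorems.EventualTightUMA

/-! ## The averaged atom implies the crux -/

/-- **The averaged one-scale step**: eventual tightness of the coarse count and an eventual bound on the joint
event "fine count `≥ k`, coarse count `< m`" give eventual tightness of the fine count, by
`P[A] ≤ P[C] + P[A ∩ Cᶜ]`. [folklore] -/
theorem fine_of_coarse_of_avgAtom (D : DobrushinDomain) (a b : ℝ → Site 2) (y : ℂ) (s t : ℝ)
    (hC : ∀ ε : ℝ, 0 < ε → ∃ (m : ℕ) (δ₁ : ℝ), 0 < δ₁ ∧ ∀ δ ∈ Set.Ioc (0 : ℝ) δ₁,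
      SAW.law D.carrier δ (a δ) (b δ)
        {γ | (⟨γ.walk.toCurve (meshPoint δ)⟩ : Curve ℂ).HasTraversals m y (6 * s / 5) (2 * s)} ≤
        ENNReal.ofReal ε)
    (hU : ∀ (m : ℕ) (θ : ℝ), 0 < θ → ∃ (k : ℕ) (δ₀ : ℝ), 0 < δ₀ ∧ ∀ δ ∈ Set.Ioc (0 : ℝ) δ₀,
      SAW.law D.carrier δ (a δ) (b δ)
          {γ | (⟨γ.walk.toCurve (meshPoint δ)⟩ : Curve ℂ).HasTraversals k y (t * s) s ∧
            ¬ (⟨γ.walk.toCurve (meshPoint δ)⟩ : Curve ℂ).HasTraversals m y (6 * s / 5) (2 * s)} ≤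
        ENNReal.ofReal θ) :
    ∀ ε : ℝ, 0 < ε → ∃ (k : ℕ) (δ₁ : ℝ), 0 < δ₁ ∧ ∀ δ ∈ Set.Ioc (0 : ℝ) δ₁,
      SAW.law D.carrier δ (a δ) (b δ)
        {γ | (⟨γ.walk.toCurve (meshPoint δ)⟩ : Curve ℂ).HasTraversals k y (t * s) s} ≤
        ENNReal.ofReal ε := by
  intro ε hε
  have hε2 : 0 < ε / 2 := by positivity
  obtain ⟨m, δ₁, hδ₁, hCm⟩ := hC (ε / 2) hε2
  obtain ⟨k, δ₀, hδ₀, hUk⟩ := hU m (ε / 2) hε2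
  refine ⟨k, min δ₁ δ₀, lt_min hδ₁ hδ₀, fun δ hδ => ?_⟩
  have hδ1 : δ ∈ Set.Ioc (0 : ℝ) δ₁ := ⟨hδ.1, hδ.2.trans (min_le_left _ _)⟩
  have hδ0 : δ ∈ Set.Ioc (0 : ℝ) δ₀ := ⟨hδ.1, hδ.2.trans (min_le_right _ _)⟩
  set A : Set (SAW.DomainSAW D.carrier δ (a δ) (b δ)) :=
    {γ | (⟨γ.walk.toCurve (meshPoint δ)⟩ : Curve ℂ).HasTraversals k y (t * s) s} with hA
  set C : Set (SAW.DomainSAW D.carrier δ (a δ) (b δ)) :=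
    {γ | (⟨γ.walk.toCurve (meshPoint δ)⟩ : Curve ℂ).HasTraversals m y (6 * s / 5) (2 * s)} with hC'
  have hAC : A ∩ Cᶜ = {γ | (⟨γ.walk.toCurve (meshPoint δ)⟩ : Curve ℂ).HasTraversals k y (t * s) s ∧
      ¬ (⟨γ.walk.toCurve (meshPoint δ)⟩ : Curve ℂ).HasTraversals m y (6 * s / 5) (2 * s)} := by
    ext γ
    simp only [Set.mem_inter_iff, Set.mem_setOf_eq, Set.mem_compl_iff, hA, hC']
  calc SAW.law D.carrier δ (a δ) (b δ) A
      ≤ SAW.law D.carrier δ (a δ) (b δ) (C ∪ (A ∩ Cᶜ)) :=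
        measure_mono fun γ hγ => by
          by_cases hc : γ ∈ C
          · exact Or.inl hc
          · exact Or.inr ⟨hγ, hc⟩
    _ ≤ SAW.law D.carrier δ (a δ) (b δ) C + SAW.law D.carrier δ (a δ) (b δ) (A ∩ Cᶜ) :=
        measure_union_le _ _
    _ ≤ ENNReal.ofReal (ε / 2) + ENNReal.ofReal (ε / 2) := by
        gcongr
        · exact hCm δ hδ1
        · rw [hAC]; exact hUk δ hδ0
    _ = ENNReal.ofReal ε := by rw [← ENNReal.ofReal_add hε2.le hε2.le, add_halves]

/-- **The averaged atom gives per-shell eventual tightness of the traversal count, for EVERY shell** (same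
induction as `perShellDecay_of_uma`: free base `not_hasTraversals_far` at the scales `2s ≥ R₀`, then down the
ranges `(R₀/2ⁿ, R₀]`, the step being `fine_of_coarse_of_avgAtom`). [cite: AizenmanBurchardDuke1999, Thms 1.1-1.2] -/
theorem perShellDecay_of_umaAvg
    (hA : ∀ (D : DobrushinDomain) (a b : ℝ → Site 2), SAW.IsEndpointApprox D a b →
      ∀ (y : ℂ) (s t : ℝ), 0 < s → 0 < t → t < 1 → ∀ (m : ℕ) (θ : ℝ), 0 < θ →
        ∃ (k : ℕ) (δ₀ : ℝ), 0 < δ₀ ∧ ∀ δ ∈ Set.Ioc (0 : ℝ) δ₀,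
          SAW.law D.carrier δ (a δ) (b δ)
              {γ | (⟨γ.walk.toCurve (meshPoint δ)⟩ : Curve ℂ).HasTraversals k y (t * s) s ∧
                ¬ (⟨γ.walk.toCurve (meshPoint δ)⟩ : Curve ℂ).HasTraversals m y (6 * s / 5) (2 * s)} ≤
            ENNReal.ofReal θ)
    (D : DobrushinDomain) (a b : ℝ → Site 2) (hab : SAW.IsEndpointApprox D a b) :
    ∀ (x : ℂ) (ρ R : ℝ), 0 < ρ → ρ < R → ∀ ε : ℝ, 0 < ε →
      ∃ (k : ℕ) (δ₁ : ℝ), 0 < δ₁ ∧ ∀ δ ∈ Set.Ioc (0 : ℝ) δ₁,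
        SAW.law D.carrier δ (a δ) (b δ)
          {γ | (⟨γ.walk.toCurve (meshPoint δ)⟩ : Curve ℂ).HasTraversals k x ρ R} ≤ ENNReal.ofReal ε := by
  intro x ρ R hρ hρR ε hε
  obtain ⟨R₁, hR₁⟩ := (D.isBounded.closure).subset_ball x
  set R₀ : ℝ := max R₁ 1 with hR₀def
  have hR₀pos : 0 < R₀ := lt_of_lt_of_le one_pos (le_max_right _ _)
  have hΩ : closure D.carrier ⊆ Metric.ball x R₀ :=
    hR₁.trans (Metric.ball_subset_ball (le_max_left _ _))
  have htriv : ∀ r R' : ℝ, r < R' → R₀ ≤ R' → ∀ ε' : ℝ, 0 < ε' →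
      ∃ (k : ℕ) (δ₁ : ℝ), 0 < δ₁ ∧ ∀ δ ∈ Set.Ioc (0 : ℝ) δ₁,
        SAW.law D.carrier δ (a δ) (b δ)
          {γ | (⟨γ.walk.toCurve (meshPoint δ)⟩ : Curve ℂ).HasTraversals k x r R'} ≤
          ENNReal.ofReal ε' := by
    intro r R' hrR' hR' ε' _
    refine ⟨1, 1, one_pos, fun δ _ => ?_⟩
    have hempty : {γ : SAW.DomainSAW D.carrier δ (a δ) (b δ) |
        (⟨γ.walk.toCurve (meshPoint δ)⟩ : Curve ℂ).HasTraversals 1 x r R'} = ∅ :=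
      Set.eq_empty_iff_forall_notMem.2 fun γ hγ =>
        not_hasTraversals_far hΩ hrR' hR' γ one_ne_zero hγ
    rw [hempty, measure_empty]
    exact bot_le
  have hclaim : ∀ n : ℕ, ∀ s : ℝ, R₀ / 2 ^ n < s → s ≤ R₀ → ∀ t : ℝ, 0 < t → t < 1 →
      ∀ ε' : ℝ, 0 < ε' → ∃ (k : ℕ) (δ₁ : ℝ), 0 < δ₁ ∧ ∀ δ ∈ Set.Ioc (0 : ℝ) δ₁,
        SAW.law D.carrier δ (a δ) (b δ)
          {γ | (⟨γ.walk.toCurve (meshPoint δ)⟩ : Curve ℂ).HasTraversals k x (t * s) s} ≤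
          ENNReal.ofReal ε' := by
    intro n
    induction n with
    | zero =>
      intro s hs1 hs2
      rw [pow_zero, div_one] at hs1
      exact absurd hs2 (not_le.2 hs1)
    | succ n ih =>
      intro s hs1 hs2 t ht ht1
      have hs0 : 0 < s := lt_trans (div_pos hR₀pos (pow_pos two_pos _)) hs1
      refine fine_of_coarse_of_avgAtom D a b x s t ?_ (hA D a b hab x s t hs0 ht ht1)
      by_cases h2s : R₀ ≤ 2 * s
      · exact htriv (6 * s / 5) (2 * s) (by linarith) h2s
      · push Not at h2s
        have hrange : R₀ / 2 ^ n < 2 * s := by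
          have e : R₀ / 2 ^ n = 2 * (R₀ / 2 ^ (n + 1)) := by
            rw [pow_succ]
            field_simp
          rw [e]
          linarith
        have h := ih (2 * s) hrange h2s.le (3 / 5) (by norm_num) (by norm_num)
        have e : (3 : ℝ) / 5 * (2 * s) = 6 * s / 5 := by ring
        rw [e] at h
        exact h
  by_cases hfarR : R₀ ≤ R
  · exact htriv ρ R hρR hfarR ε hε
  · push Not at hfarR
    have hRpos : 0 < R := hρ.trans hρR
    obtain ⟨n, hn⟩ : ∃ n : ℕ, R₀ / 2 ^ n < R := by
      obtain ⟨n, hn⟩ := exists_pow_lt_of_lt_one (div_pos hRpos hR₀pos) (by norm_num : (1 : ℝ) / 2 < 1)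
      refine ⟨n, ?_⟩
      have h1 : R₀ / 2 ^ n = R₀ * (1 / 2) ^ n := by
        rw [div_eq_mul_inv, one_div, inv_pow]
      rw [h1]
      calc R₀ * (1 / 2) ^ n < R₀ * (R / R₀) := mul_lt_mul_of_pos_left hn hR₀pos
        _ = R := by field_simp
    have h := hclaim n R hn hfarR.le (ρ / R) (div_pos hρ hRpos) ((div_lt_one hRpos).2 hρR) ε hε
    have e : ρ / R * R = ρ := by field_simp
    rw [e] at h
    exact h

/-- **The AVERAGED atom already implies the crux** (registered stub `EventualTight_of_umaAvg` of
stmt-CriticalPhenomena-1881): per-shell tightness (`perShellDecay_of_umaAvg`) ⇒ `ShellCrossingBound` form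
(landed `shellCrossing_of_perShellDecay`) ⇒ set-form tightness (landed `TightOfShellCrossing_proof`) ⇒ the
along-the-mesh crux (bridge). [cite: AizenmanBurchardDuke1999, Thms 1.1-1.2] -/
theorem EventualTight_of_umaAvg :
    (∀ (D : Literature.Probability.RandomPlanarGeometry.DobrushinDomain)
      (a b : ℝ → Literature.Probability.LatticeModels.Site 2),
      Literature.Probability.RandomPlanarGeometry.SAW.IsEndpointApprox D a b →
      ∀ (y : ℂ) (s t : ℝ), 0 < s → 0 < t → t < 1 → ∀ (m : ℕ) (θ : ℝ), 0 < θ →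
        ∃ (k : ℕ) (δ₀ : ℝ), 0 < δ₀ ∧ ∀ δ ∈ Set.Ioc (0 : ℝ) δ₀,
          Literature.Probability.RandomPlanarGeometry.SAW.law D.carrier δ (a δ) (b δ)
              {γ | (⟨γ.walk.toCurve (Literature.Probability.LatticeModels.meshPoint δ)⟩ :
                    Literature.Probability.RandomPlanarGeometry.Curve ℂ).HasTraversals k y (t * s) s ∧
                ¬ (⟨γ.walk.toCurve (Literature.Probability.LatticeModels.meshPoint δ)⟩ :
                    Literature.Probability.RandomPlanarGeometry.Curve ℂ).HasTraversals m y (6 * s / 5)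
                    (2 * s)} ≤
            ENNReal.ofReal θ) →
      Summit.CriticalPhenomena.SAWScalingLimit.Theses.SAWTwistedSelfEnergy.EventualTight := by
  intro hA
  have hSCB : Summit.CriticalPhenomena.SAWScalingLimit.Theses.SAWRenewalTightness.ShellCrossingBound :=
    fun D a b hab => shellCrossing_of_perShellDecay D a b (perShellDecay_of_umaAvg hA D a b hab)
  have hT := TightOfShellCrossing_proof hSCB
  intro D a b hab
  obtain ⟨δ₀, hδ₀, hTight⟩ := hT D a b hab
  exact isTightAlongMesh_of_isTightMeasureSet_image
    (Eventually.of_forall fun δ => SAW.aemeasurable_curve D.carrier δ (a δ) (b δ)) hδ₀ hTight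

/-! ## The crux implies the averaged atom, and UMA at the top scales -/

/-- An eventual property along `𝓝[>] 0` holds on an initial interval `(0, δ₀]`. [folklore] -/
theorem exists_Ioc_of_eventually {p : ℝ → Prop} (h : ∀ᶠ δ in 𝓝[>] (0 : ℝ), p δ) :
    ∃ δ₀ : ℝ, 0 < δ₀ ∧ ∀ δ ∈ Set.Ioc (0 : ℝ) δ₀, p δ := by
  rw [eventually_nhdsWithin_iff, Metric.eventually_nhds_iff] at h
  obtain ⟨ε, hε, H⟩ := h
  refine ⟨ε / 2, half_pos hε, fun δ hδ => H ?_ hδ.1⟩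
  rw [Real.dist_eq, sub_zero, abs_of_pos hδ.1]
  linarith [hδ.2]

/-- **The crux implies the averaged atom** (registered stub `umaAvg_of_EventualTight` of
stmt-CriticalPhenomena-1881): along-the-mesh tightness gives, for every `θ > 0`, a compact set of curve classes
missed with probability `≤ θ` for all small `δ`; a compact set bounds the number of separate traversals of the
genuine shell `D(y; ts, s)` (`exists_forall_not_hasTraversals_of_isCompact`), so the joint event is eventually
`θ`-small in law (the coarse clause is simply dropped).  Hence the averaged atom is crux-EQUIVALENT
(`EventualTight_of_umaAvg`). [cite: AizenmanBurchardDuke1999, §1.b and Lemma 4.1] -/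
theorem umaAvg_of_EventualTight :
    Summit.CriticalPhenomena.SAWScalingLimit.Theses.SAWTwistedSelfEnergy.EventualTight →
      ∀ (D : Literature.Probability.RandomPlanarGeometry.DobrushinDomain)
        (a b : ℝ → Literature.Probability.LatticeModels.Site 2),
        Literature.Probability.RandomPlanarGeometry.SAW.IsEndpointApprox D a b →
        ∀ (y : ℂ) (s t : ℝ), 0 < s → 0 < t → t < 1 → ∀ (m : ℕ) (θ : ℝ), 0 < θ →
          ∃ (k : ℕ) (δ₀ : ℝ), 0 < δ₀ ∧ ∀ δ ∈ Set.Ioc (0 : ℝ) δ₀,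
            Literature.Probability.RandomPlanarGeometry.SAW.law D.carrier δ (a δ) (b δ)
                {γ | (⟨γ.walk.toCurve (Literature.Probability.LatticeModels.meshPoint δ)⟩ :
                      Literature.Probability.RandomPlanarGeometry.Curve ℂ).HasTraversals k y (t * s) s ∧
                  ¬ (⟨γ.walk.toCurve (Literature.Probability.LatticeModels.meshPoint δ)⟩ :
                      Literature.Probability.RandomPlanarGeometry.Curve ℂ).HasTraversals m y (6 * s / 5)
                      (2 * s)} ≤
              ENNReal.ofReal θ := by
  intro hT D a b hab y s t hs ht ht1 m θ hθ
  have hts : t * s < s := by nlinarith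
  obtain ⟨K, hK, hev⟩ := hT D a b hab (ENNReal.ofReal θ) (ENNReal.ofReal_pos.2 hθ)
  obtain ⟨k, hk⟩ :=
    ShellCrossingBound.Negative.exists_forall_not_hasTraversals_of_isCompact hK y hts
  obtain ⟨δ₀, hδ₀, H⟩ := exists_Ioc_of_eventually hev
  refine ⟨k, δ₀, hδ₀, fun δ hδ => le_trans (measure_mono fun γ hγ => ?_) (H δ hδ)⟩
  exact fun hmem => hk _ hmem hγ.1

/-- **Top-scale fibres are trivial.**  If `Ω ⊆ B(y, r)` then no edge of a walk of `Ω_δ` has an endpoint at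
mesh distance `≥ r` from `y` (both endpoints of an edge of `Ω_δ` have mesh points in `Ω`), so any two walks
agree on the outside edges at radius `r`: every fibre of the unordered outside trace is everything. [folklore] -/
theorem outAgree_of_subset_ball {Ω : Set ℂ} {δ : ℝ} {a b : Site 2} {y : ℂ} {r : ℝ}
    (hΩ : Ω ⊆ Metric.ball y r) (γ γ₀ : SAW.DomainSAW Ω δ a b) :
    ∀ e : Sym2 (Site 2), (∃ v : Site 2, v ∈ e ∧ r ≤ dist (meshPoint δ v) y) →
      (e ∈ γ.walk.edges ↔ e ∈ γ₀.walk.edges) := by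
  -- an edge of a walk of `Ω_δ` has both endpoints at mesh distance `< r` from `y`
  have key : ∀ {u v : Site 2} (w : (discreteDomainGraph Ω δ).Walk u v) (e : Sym2 (Site 2)),
      e ∈ w.edges → ∀ z : Site 2, z ∈ e → dist (meshPoint δ z) y < r := by
    intro u v w e he z hz
    have hE : e ∈ (discreteDomainGraph Ω δ).edgeSet := w.edges_subset_edgeSet he
    obtain ⟨z', rfl⟩ := (Sym2.mem_iff_exists.1 hz)
    have hadj : (discreteDomainGraph Ω δ).Adj z z' := by
      rwa [SimpleGraph.mem_edgeSet] at hE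
    have hzΩ : meshPoint δ z ∈ Ω :=
      meshDomain_subset_meshVertices Ω δ (discreteDomainGraph_adj_iff.1 hadj).2.1
    exact Metric.mem_ball.1 (hΩ hzΩ)
  intro e ⟨v, hv, hrv⟩
  constructor
  · intro he
    exact absurd (key γ.walk e he v hv) (not_lt.2 hrv)
  · intro he
    exact absurd (key γ₀.walk e he v hv) (not_lt.2 hrv)

/-- The critical SAW law has total mass `0` or `1`. [folklore] -/
theorem law_univ_eq_zero_or_one {Ω : Set ℂ} {δ : ℝ} {a b : Site 2} :
    SAW.law Ω δ a b Set.univ = 0 ∨ SAW.law Ω δ a b Set.univ = 1 := by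
  rw [SAW.law_apply_eq_inv_mul_weight]
  rcases eq_or_ne (SAW.weight Ω δ a b Set.univ) 0 with h | h
  · left; simp [h]
  rcases eq_or_ne (SAW.weight Ω δ a b Set.univ) ⊤ with h' | h'
  · left; simp [h']
  · right; rw [ENNReal.inv_mul_cancel h h']

/-- **The crux implies UMA at the top scales** (registered stub `umaTop_of_EventualTight` of
stmt-CriticalPhenomena-1881): for discs `B(y, 2s) ⊇ Ω` the fibres of the outside trace are trivial
(`outAgree_of_subset_ball`), so the fibrewise atom is the averaged one (`umaAvg_of_EventualTight`) — UMA's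
top-scale instances are plain per-shell tightness of `D(y; ts, s)`, crux-implied; its surplus over the crux
is the fibrewise uniformity at the scales where `B(y, 2s)` does not cover `Ω`. [folklore] -/
theorem umaTop_of_EventualTight :
    Summit.CriticalPhenomena.SAWScalingLimit.Theses.SAWTwistedSelfEnergy.EventualTight →
      ∀ (D : Literature.Probability.RandomPlanarGeometry.DobrushinDomain)
        (a b : ℝ → Literature.Probability.LatticeModels.Site 2),
        Literature.Probability.RandomPlanarGeometry.SAW.IsEndpointApprox D a b →
        ∀ (y : ℂ) (s t : ℝ), 0 < s → 0 < t → t < 1 → D.carrier ⊆ Metric.ball y (2 * s) →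
          ∀ (m : ℕ) (θ : ℝ), 0 < θ →
          ∃ (k : ℕ) (δ₀ : ℝ), 0 < δ₀ ∧ ∀ δ ∈ Set.Ioc (0 : ℝ) δ₀,
            ∀ γ₀ : Literature.Probability.RandomPlanarGeometry.SAW.DomainSAW D.carrier δ (a δ) (b δ),
              Literature.Probability.RandomPlanarGeometry.SAW.law D.carrier δ (a δ) (b δ)
                  {γ | (∀ e : Sym2 (Literature.Probability.LatticeModels.Site 2),
                      (∃ v : Literature.Probability.LatticeModels.Site 2,
                        v ∈ e ∧ 2 * s ≤ dist (Literature.Probability.LatticeModels.meshPoint δ v) y) →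
                      (e ∈ γ.walk.edges ↔ e ∈ γ₀.walk.edges)) ∧
                    (⟨γ.walk.toCurve (Literature.Probability.LatticeModels.meshPoint δ)⟩ :
                        Literature.Probability.RandomPlanarGeometry.Curve ℂ).HasTraversals k y (t * s) s ∧
                    ¬ (⟨γ.walk.toCurve (Literature.Probability.LatticeModels.meshPoint δ)⟩ :
                        Literature.Probability.RandomPlanarGeometry.Curve ℂ).HasTraversals m y (6 * s / 5)
                        (2 * s)} ≤
                ENNReal.ofReal θ *
                  Literature.Probability.RandomPlanarGeometry.SAW.law D.carrier δ (a δ) (b δ)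
                    {γ | ∀ e : Sym2 (Literature.Probability.LatticeModels.Site 2),
                      (∃ v : Literature.Probability.LatticeModels.Site 2,
                        v ∈ e ∧ 2 * s ≤ dist (Literature.Probability.LatticeModels.meshPoint δ v) y) →
                      (e ∈ γ.walk.edges ↔ e ∈ γ₀.walk.edges)} := by
  intro hT D a b hab y s t hs ht ht1 hΩ m θ hθ
  obtain ⟨k, δ₀, hδ₀, H⟩ := umaAvg_of_EventualTight hT D a b hab y s t hs ht ht1 m θ hθ
  refine ⟨k, δ₀, hδ₀, fun δ hδ γ₀ => ?_⟩
  -- the fibre of `γ₀` is everything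
  have hfib : {γ : SAW.DomainSAW D.carrier δ (a δ) (b δ) |
      ∀ e : Sym2 (Site 2), (∃ v : Site 2, v ∈ e ∧ 2 * s ≤ dist (meshPoint δ v) y) →
        (e ∈ γ.walk.edges ↔ e ∈ γ₀.walk.edges)} = Set.univ :=
    Set.eq_univ_of_forall fun γ => outAgree_of_subset_ball hΩ γ γ₀
  rw [hfib]
  rcases law_univ_eq_zero_or_one (Ω := D.carrier) (δ := δ) (a := a δ) (b := b δ) with h0 | h1
  · exact le_trans (measure_mono (Set.subset_univ _)) (by rw [h0]; exact bot_le)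
  · rw [h1, mul_one]
    exact le_trans (measure_mono fun γ hγ => hγ.2) (H δ hδ)

end Summit.CriticalPhenomena.SAWScalingLimit.Theorems.EventualTightUMA

end
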